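import Literature.NumberTheory.EllipticCurves.LocalTorsionGoodReductionProofs
import Literature.NumberTheory.EllipticCurves.ModularCurvePeriodRatio
import Summits.BirchSwinnertonDyer.Rank1Residual.Additive.X4RankZeroKuriharaWitness
import Summits.BirchSwinnertonDyer.Rank1Residual.X11a.MainConjectureCertificates
import HarnessLib

/-!
# Class X11a, print route: the DEEP Kurihara-number door for the LOWER half — Kim 2026 Thm. 1.8 (6)
# beyond the unit case (a Kurihara number non-zero modulo `p^k` at a level `n ∈ 𝒩_k`,
# `k ≤ ord_p ∏ c_ℓ + 1`) discharged on `ClassX11a ∧ 5 ≤ p ∧ Surj`, per pair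

HONEST FRAMING (cell bsd-print-x11a, HOME run/shared/lean/pub/bsd-print-x11a/; seat p1 g3, PLAN v2 §2
fallback «per-pair L instances»; memo P1-ROAD.md §8). THEOREMS ONLY (no definition, no fact minted,
no sorry); every published input is an explicit NAMED-FACT hypothesis already in the tree. PER PAIR (a
certificate is an input): NOT a class theorem, nothing booked, no label changes, PARTITION 0 until a
record feeds it. «beyond-print theorem: NO».

WHY. Crux stmt-BirchSwinnertonDyer-19064 `X11aLowerHalf` (= `Typed.MissingLowerBoundAt`,
`ord_p #Ш_an ≤ ord_p #Ш`) is open class-wide on the surjective leaf; per pair the tree's Kim door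
`Typed.X11RankZero.bsdp_of_kim_of_kuriharaNumber_ne_zero` (Kim 2026 Thm. 1.8 (6) from ONE UNIT
Kurihara number) carries `p ∤ ∏ c_ℓ` — and by Kim's Conjecture 1.10 (`∂^{(∞)}(δ̃) = ∑ ord_p c_ℓ`) NO
unit Kurihara number exists on a pair with `p ∣ ∏ c_ℓ`. On X11a such pairs are typical: «no (ram)
prime» means every multiplicative `q ≠ p` has `p ∣ ord_q Δ_min`, so `p ∣ c_q` as soon as `q` is split.
Of the surjective leaf pairs @5 with `N < 5·10⁵` still open per pair in the route text
(`Theses/PrintX11a.lean`, CHEAPEST FALSIFIER), the b2b table `b2b-bsdres-x11a/g23/MU-TABLE-727.md`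
gives `∏ c_ℓ` = 30 (285660u1), 10 (320045bh1), 10 (375440db1), 20 (419120cq1), 20 (490960cp1): all
with `ord_5 ∏ c_ℓ = 1`, i.e. OUT of the unit door. The tree already holds the PRINTED theorem that
serves them: `Kim2026.rankZero_le_padicValNat_sha_of_kuriharaNumber_ne_zero` (Kim, Amer. J. Math. 148
(2026) Thm. 1.8 (6) beyond the unit case: a Kurihara number `δ̃_n^{(k)} ≠ 0` at a cyclic level
`n ∈ 𝒩_k` gives `ord_p(L(E,1)/Ω(W)) ≤ ord_p #Ш(E/ℚ)(p) + (k − 1)`; NO hypothesis on the reduction at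
`p`; flag `K26-(6)-shallow@t>0` with the PROOF-COVERED `(t0)` twin
`…_of_localTorsionTrivial`), consumed so far only on X4 (additive `p`,
`X4/KuriharaLowerHalfSocket.lean`) — NOT on X11a. This file is the X11a door:

* §1 `ClassX11a.missingLowerBoundAt_of_kimDeep` — `ClassX11a W p`, `5 ≤ p`, `ρ̄_{E,p}` onto, a modular
  parametrisation datum `D` with `p ∤ c_D` (Kim's Manin hypothesis; displayed — per pair it is Mazur
  1978 Cor. 4.1 for the optimal curve, `mazur_not_dvd_maninConstant_of_odd`), a level `k` with
  `1 ≤ k ≤ ord_p ∏ c_ℓ + 1`, `n ∈ 𝒩_k` with cyclic `Ẽ(𝔽_ℓ)[p]`, discrete logarithms `ψ ↠ ℤ/p^k` and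
  the certificate `kuriharaNumber D.f (p^k) n ψ ≠ 0` ⟹ `Typed.MissingLowerBoundAt W p`. Class-wide
  discharges: `L(E,1) ≠ 0` (`r_an = 0`, modularity `hmod`), `Ш` finite (GZK), the period transfer
  `Ω(W) = u·Ω⁺_f`, `|u|_p = 1` at a multiplicative `p ≥ 5` with irreducible `E[p]` (named fact
  `realPeriodRat_eq_unit_mul_plusPeriod_of_multiplicative`: Greenberg–Vatsal Rem. 3.4 + Mazur + Edixhoven),
  `p ∤ #E(ℚ)_tors` (irreducible), and the bookkeeping `#Ш_an = (L(E,1)/Ω)·#tors²/∏c`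
  (`Additive.missingLowerBoundAt_of_rankZero_of_LOmegaWitness`, class-free, reused).
* §2 `ClassX11a.missingLowerBoundAt_of_kimDeep_of_localTorsionTrivial` — the same through the
  PROOF-COVERED twin, its `(t0)` binder `#E(ℚ_p)[p] = 1` discharged on the multiplicative locus
  «non-split at `p`, or `p ∤ v_p(Δ_min)`» (`natCard_localPTorsion_eq_one_of_mult`, AEC VII.6.1 /
  Ex. 3.5); `…_of_nonsplit` the non-split corollary (375440db1, 419120cq1, 490960cp1 are non-split @5).
* §3 `ClassX11a.bsdp_of_kimDeep[_of_localTorsionTrivial]` — plus Wuthrich 2014 Prop. 21 (`hWu`, the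
  Euler half at surjective image) ⟹ `BSD(E,p)` (`X11a.bsdp_iff_missingLowerBoundAt_of_surj`).

WHAT A RECORD MUST SUPPLY (kit engine, two engines + REF per cell rules): for `p = 5`, `k = 2`: primes
`ℓ ∤ 5N`, `ℓ ≡ 1 (mod 25)`, `a_ℓ ≡ ℓ + 1 (mod 25)`, `#Ẽ(𝔽_ℓ)[5] = 5`; `n = ℓ` or `ℓ₁ℓ₂`; `δ̃_n mod 25 ≠ 0`
(it is `≡ 0 mod 5` by Kato + Kim (6), as `5 ∣ ∏ c_ℓ`); `p ∤ c_D` (optimality / Mazur); for §2 the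
split type at `p` or `v_p(Δ_min) mod p`. The modular symbols `[a/n]⁺` at these conductors were already
computed exactly by the b2b engines at level `k = 1` (`KimRecords*.lean`, gens 12/17); level 2 needs
the `𝒫_2` primes and the same symbols read modulo `25`.

References: [Kim2022StructureSelmer] C.-H. Kim, Amer. J. Math. 148 (2026) 79–129 = arXiv:2203.12159,
Thm. 1.9 (6) (= journal Thm. 1.8 (6)), §1.5.1, Conj. 1.10, Prop. 3.2, Thm. 3.13; [Mazur1978] Cor. 4.1;
[GreenbergVatsal2000] Rem. 3.4; [SilvermanAEC2009] VII.3 Prop. 3.1, VII.6.1; [Wuthrich2014] Prop. 21;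
[Miller2011LMS] Def. 1.1; tree: `Kim2026/ShaLengthRankZeroLowerBound.lean`,
`LocalTorsionGoodReductionProofs.lean`, `Additive/X4RankZeroKuriharaWitness.lean`,
`X4/KuriharaLowerHalfSocket.lean` (the X4 twin), `X11a/MainConjectureCertificates.lean`.
-/

set_option autoImplicit false

noncomputable section

open scoped Classical MatrixGroups ModularForm

open CongruenceSubgroup WeierstrassCurve Literature.NumberTheory.EllipticCurves
  Literature.NumberTheory.EllipticCurves.ModularForms
  Literature.NumberTheory.EllipticCurves.Rank1Residual
  Literature.NumberTheory.EllipticCurves.Rank1Residual.Typed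
  Literature.NumberTheory.EllipticCurves.Wuthrich2014

namespace Summit.BirchSwinnertonDyer.Rank1Residual.X11a

variable {W : WeierstrassCurve ℚ} [W.IsElliptic] [W.IsGloballyMinimal] {p : ℕ} [Fact p.Prime]

/-! ### §1 The deep Kurihara certificate gives the LOWER half on `ClassX11a ∧ 5 ≤ p ∧ Surj` -/

/-- **X11a, per pair: the lower half `ord_p #Ш_an ≤ ord_p #Ш` from ONE Kurihara number non-zero
modulo `p^k` at a level `n ∈ 𝒩_k` with `k ≤ ord_p ∏ c_ℓ + 1`** (Kim 2026 Thm. 1.8 (6) beyond the unit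
case, named fact `hKim`, literal form — flag `K26-(6)-shallow@t>0`, see §2 for the proof-covered
twin). Class-wide discharges: `L(E,1) ≠ 0` from `r_an = 0` (modularity `hmod`), `Ш` finite (GZK
`hGZK`), the period transfer at a multiplicative `p ≥ 5` with irreducible `E[p]` (`hϖ`),
`p ∤ #E(ℚ)_tors` (irreducible); displayed per pair: the parametrisation datum `D` with `p ∤ c_D`, the
level `k`, `n`, the cyclicity of `Ẽ(𝔽_ℓ)[p]`, `ψ`, the certificate. Since
`ord_p(L(E,1)/Ω) = ord_p #Ш_an + ord_p ∏ c_ℓ` (rank `0`, `p ∤ #tors`), Kim's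
`ord_p(L(E,1)/Ω) ≤ ord_p #Ш(p) + (k − 1)` is the lower half as soon as `k − 1 ≤ ord_p ∏ c_ℓ`. Per pair;
NOT a class theorem. [cite: Kim2022StructureSelmer, Thm. 1.9 (6) (PDF p. 8) and §1.5.1 (PDF p. 7)]
[cite: GreenbergVatsal2000, §3 Remark 3.4] [cite: Miller2011LMS, Def. 1.1 (arXiv:1010.2431 p. 3)] -/
theorem _root_.Summit.BirchSwinnertonDyer.Rank1Residual.ClassX11a.missingLowerBoundAt_of_kimDeep
    (hKim : Kim2026.rankZero_le_padicValNat_sha_of_kuriharaNumber_ne_zero)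
    (hϖ : realPeriodRat_eq_unit_mul_plusPeriod_of_multiplicative)
    (hGZK : rank_eq_analyticRank_of_analyticRank_le_one) (hmod : hasEntireLFunction_rat)
    (hX : ClassX11a W p) (hp : 5 ≤ p) (hsurj : Surj W p)
    {N : ℕ} [NeZero N] (D : ModularParametrizationData W N) (hc : ¬ (p : ℤ) ∣ D.maninConstant)
    (k n : ℕ) [NeZero n] (hk : 1 ≤ k) (hkc : k ≤ padicValNat p W.tamagawaProduct + 1)
    (hn : Kato.IsKolyvaginProduct W p k n)
    (hcyc : ∀ (ℓ : ℕ) [Fact ℓ.Prime], ℓ ∣ n →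
      Nat.card {P : ((WeierstrassCurve.integralModelInt W).map
          (Int.castRingHom (ZMod ℓ))).toAffine.Point // p • P = 0} ≤ p)
    (ψ : (ℓ : ℕ) → (ZMod ℓ)ˣ →* Multiplicative (ZMod (p ^ k)))
    (hψ : ∀ ℓ ∈ n.primeFactors, Function.Surjective (ψ ℓ))
    (hδ : kuriharaNumber D.f (p ^ k) n ψ ≠ 0) : MissingLowerBoundAt W p := by
  have hr : W.analyticRank = 0 := hX.1
  have hL : W.entireLFunction 1 ≠ 0 := (W.analyticRank_eq_zero_iff_holds (hmod W)).mp hr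
  have hfin : Finite W.sha := (hGZK W (by rw [hr]; exact zero_le_one)).2
  have hper : ∃ u : ℚ, ‖(u : ℚ_[p])‖ = 1 ∧ W.realPeriodRat = u * plusPeriod D.f :=
    hϖ W p hp hX.2.2.1 hX.2.2.2.1 D.f D.isNewformOf
  obtain ⟨q, hq, hval⟩ := hKim W p hp hsurj hL hfin D hc hper k n hk hn hcyc ψ hψ hδ
  refine Additive.missingLowerBoundAt_of_rankZero_of_LOmegaWitness W p hGZK hmod hr hX.2.2.2.1 hq
    (j := k - 1) (by omega) ?_
  linarith

/-! ### §2 The proof-covered twin, `(t0)` discharged on the multiplicative locus -/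

/-- **The same through the PROOF-COVERED twin** (`hKim0 = …_of_localTorsionTrivial`, Kim's argument
covers every depth `k ≥ 1` when `E(ℚ_p)[p] = 0`), with the `(t0)` binder `#E(ℚ_p)[p] = 1` DISCHARGED
on the multiplicative locus «`E` non-split at `p`, or `p ∤ v_p(Δ_min)`» (Tate curve:
`natCard_localPTorsion_eq_one_of_mult`, Silverman AEC VII.6.1 / Ex. 3.5) — displayed as the disjunction
`h0`, read off the record's split type / `v_p(Δ_min)`. Per pair; NOT a class theorem.
[cite: Kim2022StructureSelmer, Thm. 1.9 (6) (PDF p. 8), Prop. 3.2 (PDF p. 15), Thm. 3.13 (PDF p. 17)]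
[cite: SilvermanAEC2009, VII.3 Prop. 3.1, Thm. VII.6.1 and Exercise 3.5] [cite: Miller2011LMS, Def. 1.1] -/
theorem _root_.Summit.BirchSwinnertonDyer.Rank1Residual.ClassX11a.missingLowerBoundAt_of_kimDeep_of_localTorsionTrivial
    (hKim0 : Kim2026.rankZero_le_padicValNat_sha_of_kuriharaNumber_ne_zero_of_localTorsionTrivial)
    (hϖ : realPeriodRat_eq_unit_mul_plusPeriod_of_multiplicative)
    (hGZK : rank_eq_analyticRank_of_analyticRank_le_one) (hmod : hasEntireLFunction_rat)
    (hX : ClassX11a W p) (hp : 5 ≤ p) (hsurj : Surj W p)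
    (h0 : ¬ W.HasSplitMultiplicativeReductionAtPrime p ∨
      ¬ p ∣ padicValInt p W.minimalDiscriminantInt)
    {N : ℕ} [NeZero N] (D : ModularParametrizationData W N) (hc : ¬ (p : ℤ) ∣ D.maninConstant)
    (k n : ℕ) [NeZero n] (hk : 1 ≤ k) (hkc : k ≤ padicValNat p W.tamagawaProduct + 1)
    (hn : Kato.IsKolyvaginProduct W p k n)
    (hcyc : ∀ (ℓ : ℕ) [Fact ℓ.Prime], ℓ ∣ n →
      Nat.card {P : ((WeierstrassCurve.integralModelInt W).map
          (Int.castRingHom (ZMod ℓ))).toAffine.Point // p • P = 0} ≤ p)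
    (ψ : (ℓ : ℕ) → (ZMod ℓ)ˣ →* Multiplicative (ZMod (p ^ k)))
    (hψ : ∀ ℓ ∈ n.primeFactors, Function.Surjective (ψ ℓ))
    (hδ : kuriharaNumber D.f (p ^ k) n ψ ≠ 0) : MissingLowerBoundAt W p := by
  have hr : W.analyticRank = 0 := hX.1
  have hL : W.entireLFunction 1 ≠ 0 := (W.analyticRank_eq_zero_iff_holds (hmod W)).mp hr
  have hfin : Finite W.sha := (hGZK W (by rw [hr]; exact zero_le_one)).2
  have hper : ∃ u : ℚ, ‖(u : ℚ_[p])‖ = 1 ∧ W.realPeriodRat = u * plusPeriod D.f :=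
    hϖ W p hp hX.2.2.1 hX.2.2.2.1 D.f D.isNewformOf
  have ht0 : Nat.card {Q : (W.baseChange ℚ_[p]).toAffine.Point // (p : ℕ) • Q = 0} = 1 :=
    natCard_localPTorsion_eq_one_of_mult W p (by omega) hX.2.2.1 h0
  obtain ⟨q, hq, hval⟩ := hKim0 W p hp hsurj ht0 hL hfin D hc hper k n hk hn hcyc ψ hψ hδ
  refine Additive.missingLowerBoundAt_of_rankZero_of_LOmegaWitness W p hGZK hmod hr hX.2.2.2.1 hq
    (j := k - 1) (by omega) ?_
  linarith

/-- **Non-split corollary of §2** (`a_p = −1`: `(t0)` automatic). Per pair; NOT a class theorem.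
[cite: Kim2022StructureSelmer, Thm. 1.9 (6) (PDF p. 8)] [cite: SilvermanAEC2009, Thm. VII.6.1 and Exercise 3.5] -/
theorem _root_.Summit.BirchSwinnertonDyer.Rank1Residual.ClassX11a.missingLowerBoundAt_of_kimDeep_of_nonsplit
    (hKim0 : Kim2026.rankZero_le_padicValNat_sha_of_kuriharaNumber_ne_zero_of_localTorsionTrivial)
    (hϖ : realPeriodRat_eq_unit_mul_plusPeriod_of_multiplicative)
    (hGZK : rank_eq_analyticRank_of_analyticRank_le_one) (hmod : hasEntireLFunction_rat)
    (hX : ClassX11a W p) (hp : 5 ≤ p) (hsurj : Surj W p)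
    (hns : ¬ W.HasSplitMultiplicativeReductionAtPrime p)
    {N : ℕ} [NeZero N] (D : ModularParametrizationData W N) (hc : ¬ (p : ℤ) ∣ D.maninConstant)
    (k n : ℕ) [NeZero n] (hk : 1 ≤ k) (hkc : k ≤ padicValNat p W.tamagawaProduct + 1)
    (hn : Kato.IsKolyvaginProduct W p k n)
    (hcyc : ∀ (ℓ : ℕ) [Fact ℓ.Prime], ℓ ∣ n →
      Nat.card {P : ((WeierstrassCurve.integralModelInt W).map
          (Int.castRingHom (ZMod ℓ))).toAffine.Point // p • P = 0} ≤ p)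
    (ψ : (ℓ : ℕ) → (ZMod ℓ)ˣ →* Multiplicative (ZMod (p ^ k)))
    (hψ : ∀ ℓ ∈ n.primeFactors, Function.Surjective (ψ ℓ))
    (hδ : kuriharaNumber D.f (p ^ k) n ψ ≠ 0) : MissingLowerBoundAt W p :=
  hX.missingLowerBoundAt_of_kimDeep_of_localTorsionTrivial hKim0 hϖ hGZK hmod hp hsurj (Or.inl hns)
    D hc k n hk hkc hn hcyc ψ hψ hδ

/-! ### §3 With Wuthrich's Euler half: `BSD(E,p)` -/

/-- **X11a, per pair: `BSD(E,p)` from the deep Kurihara certificate** — the lower half of §1 plus the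
Euler half at surjective image (Wuthrich 2014 Prop. 21, `hWu`; `X11a.bsdp_iff_missingLowerBoundAt_of_surj`).
Per pair; NOT a class theorem. [cite: Wuthrich2014, Prop. 21 (p. 400)]
[cite: Kim2022StructureSelmer, Thm. 1.9 (6) (PDF p. 8)] [cite: Miller2011LMS, Def. 1.1] -/
theorem _root_.Summit.BirchSwinnertonDyer.Rank1Residual.ClassX11a.bsdp_of_kimDeep
    (hWu : sha_dvd_analyticSha)
    (hKim : Kim2026.rankZero_le_padicValNat_sha_of_kuriharaNumber_ne_zero)
    (hϖ : realPeriodRat_eq_unit_mul_plusPeriod_of_multiplicative)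
    (hGZK : rank_eq_analyticRank_of_analyticRank_le_one) (hmod : hasEntireLFunction_rat)
    (hX : ClassX11a W p) (hp : 5 ≤ p) (hsurj : Surj W p)
    {N : ℕ} [NeZero N] (D : ModularParametrizationData W N) (hc : ¬ (p : ℤ) ∣ D.maninConstant)
    (k n : ℕ) [NeZero n] (hk : 1 ≤ k) (hkc : k ≤ padicValNat p W.tamagawaProduct + 1)
    (hn : Kato.IsKolyvaginProduct W p k n)
    (hcyc : ∀ (ℓ : ℕ) [Fact ℓ.Prime], ℓ ∣ n →
      Nat.card {P : ((WeierstrassCurve.integralModelInt W).map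
          (Int.castRingHom (ZMod ℓ))).toAffine.Point // p • P = 0} ≤ p)
    (ψ : (ℓ : ℕ) → (ZMod ℓ)ˣ →* Multiplicative (ZMod (p ^ k)))
    (hψ : ∀ ℓ ∈ n.primeFactors, Function.Surjective (ψ ℓ))
    (hδ : kuriharaNumber D.f (p ^ k) n ψ ≠ 0) : BSDp W p :=
  (bsdp_iff_missingLowerBoundAt_of_surj hWu hGZK hmod hX hsurj).2
    (hX.missingLowerBoundAt_of_kimDeep hKim hϖ hGZK hmod hp hsurj D hc k n hk hkc hn hcyc ψ hψ hδ)

/-- **The same through the proof-covered twin** (`(t0)` from «non-split or `p ∤ v_p(Δ_min)`»).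
Per pair; NOT a class theorem. [cite: Wuthrich2014, Prop. 21 (p. 400)]
[cite: Kim2022StructureSelmer, Thm. 1.9 (6) (PDF p. 8), Prop. 3.2, Thm. 3.13] [cite: Miller2011LMS, Def. 1.1] -/
theorem _root_.Summit.BirchSwinnertonDyer.Rank1Residual.ClassX11a.bsdp_of_kimDeep_of_localTorsionTrivial
    (hWu : sha_dvd_analyticSha)
    (hKim0 : Kim2026.rankZero_le_padicValNat_sha_of_kuriharaNumber_ne_zero_of_localTorsionTrivial)
    (hϖ : realPeriodRat_eq_unit_mul_plusPeriod_of_multiplicative)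
    (hGZK : rank_eq_analyticRank_of_analyticRank_le_one) (hmod : hasEntireLFunction_rat)
    (hX : ClassX11a W p) (hp : 5 ≤ p) (hsurj : Surj W p)
    (h0 : ¬ W.HasSplitMultiplicativeReductionAtPrime p ∨
      ¬ p ∣ padicValInt p W.minimalDiscriminantInt)
    {N : ℕ} [NeZero N] (D : ModularParametrizationData W N) (hc : ¬ (p : ℤ) ∣ D.maninConstant)
    (k n : ℕ) [NeZero n] (hk : 1 ≤ k) (hkc : k ≤ padicValNat p W.tamagawaProduct + 1)
    (hn : Kato.IsKolyvaginProduct W p k n)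
    (hcyc : ∀ (ℓ : ℕ) [Fact ℓ.Prime], ℓ ∣ n →
      Nat.card {P : ((WeierstrassCurve.integralModelInt W).map
          (Int.castRingHom (ZMod ℓ))).toAffine.Point // p • P = 0} ≤ p)
    (ψ : (ℓ : ℕ) → (ZMod ℓ)ˣ →* Multiplicative (ZMod (p ^ k)))
    (hψ : ∀ ℓ ∈ n.primeFactors, Function.Surjective (ψ ℓ))
    (hδ : kuriharaNumber D.f (p ^ k) n ψ ≠ 0) : BSDp W p :=
  (bsdp_iff_missingLowerBoundAt_of_surj hWu hGZK hmod hX hsurj).2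
    (hX.missingLowerBoundAt_of_kimDeep_of_localTorsionTrivial hKim0 hϖ hGZK hmod hp hsurj h0 D hc k n
      hk hkc hn hcyc ψ hψ hδ)


/-! ### §4 One level deeper with Cassels–Tate parity: `k ≤ ord_p ∏ c_ℓ + 2` when `ord_p #Ш_an` is even
(scout kit job j284322: on the six Tamagawa-defect pairs @5 a `ν = 2` level `n = ℓ₁ℓ₂` over `𝒫_2` is
`≈ 10⁶–10⁷`, beyond the twisted-`L` engines (cost ∝ `n√N`); a SINGLE prime `ℓ ∈ 𝒫_3` (depth `k = 3`,
where Kim's `∂^{(1)}(δ̃) = 2` is visible) costs ∝ `ℓ√N`, and parity absorbs the extra level) -/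

omit [W.IsGloballyMinimal] in
/-- **Rank-`0` bookkeeping with the exact valuation** (class-free): `#Ш_an = q₀ · #E(ℚ)²_tors / ∏ c_ℓ`
for `q₀ = L(E,1)/Ω(W)`, hence `ord_p #Ш_an = ord_p q₀ − ord_p ∏ c_ℓ` when `E[p]` is irreducible
(`p ∤ #E(ℚ)_tors`, Mazur). The equality form of `Additive.missingLowerBoundAt_of_rankZero_of_LOmegaWitness`
(same computation). [cite: Miller2011LMS, Def. 1.1 (arXiv:1010.2431 p. 3)] [cite: Mazur1977, Ch. III §5] -/
theorem exists_shaAn_eq_and_padicValRat_eq_of_rankZero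
    (hGZK : rank_eq_analyticRank_of_analyticRank_le_one) (hmod : hasEntireLFunction_rat)
    (hr : W.analyticRank = 0) (hirr : W.HasIrreducibleModPGaloisRep p)
    {q₀ : ℚ} (hq₀ : W.entireLFunction 1 / (W.realPeriodRat : ℂ) = (q₀ : ℂ)) :
    ∃ q : ℚ, shaAn W = (q : ℂ) ∧
      padicValRat p q = padicValRat p q₀ - padicValNat p W.tamagawaProduct := by
  have hL : W.entireLFunction 1 ≠ 0 := (W.analyticRank_eq_zero_iff_holds (hmod W)).mp hr
  obtain ⟨hmw, hfin⟩ := hGZK W (by rw [hr]; exact zero_le_one)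
  have hmw0 : W.mordellWeilRank = 0 := by rw [hmw, hr]
  have hΩpos : 0 < W.realPeriodRat := by
    haveI : (W.baseChange ℝ).IsElliptic := by rw [baseChange]; infer_instance
    exact (W.baseChange ℝ).realPeriod_pos'
  have hΩ : (W.realPeriodRat : ℂ) ≠ 0 := by exact_mod_cast hΩpos.ne'
  rw [div_eq_iff hΩ] at hq₀
  have hq0 : q₀ ≠ 0 := by
    rintro rfl
    apply hL
    rw [hq₀]; simp
  have ht0 : (W.torsionOrder : ℚ) ≠ 0 := by exact_mod_cast (W.torsionOrder_pos_holds).ne'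
  have hc0 : (W.tamagawaProduct : ℚ) ≠ 0 := by exact_mod_cast (W.tamagawaProduct_pos').ne'
  have hsha : shaAn W = ((q₀ * (W.torsionOrder : ℚ) ^ 2 / (W.tamagawaProduct : ℚ) : ℚ) : ℂ) := by
    have hR : W.regulator = 1 := W.regulator_eq_one_of_rank_zero hmw0
    have hc0' : (W.tamagawaProduct : ℂ) ≠ 0 := by exact_mod_cast (W.tamagawaProduct_pos').ne'
    rw [shaAn_def, WeierstrassCurve.leadingLCoeff, hr, iteratedDeriv_zero, Nat.factorial_zero,
      Nat.cast_one, div_one, hq₀, hR]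
    push_cast
    field_simp
  have htors0 : padicValNat p W.torsionOrder = 0 :=
    padicValNat_torsionOrder_eq_zero_of_irreducible W p hirr
  have hvq : padicValRat p (q₀ * (W.torsionOrder : ℚ) ^ 2 / (W.tamagawaProduct : ℚ)) =
      padicValRat p q₀ - padicValNat p W.tamagawaProduct := by
    have h2 : padicValRat p ((W.torsionOrder : ℚ) ^ 2) = 2 * padicValRat p (W.torsionOrder : ℚ) := by
      rw [pow_two, padicValRat.mul ht0 ht0]; ring
    rw [padicValRat.div (mul_ne_zero hq0 (pow_ne_zero 2 ht0)) hc0,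
      padicValRat.mul hq0 (pow_ne_zero 2 ht0), h2, padicValRat.of_nat, padicValRat.of_nat, htors0]
    push_cast; ring
  exact ⟨_, hsha, hvq⟩

omit [W.IsGloballyMinimal] in
/-- **Cassels–Tate: `ord_p #Ш(E/ℚ)` is even for finite `Ш`** (`hCT`; `#Ш` is a square). [cite: SilvermanAEC2009, Thm. X.4.14] -/
theorem even_padicValNat_shaOrder_of_casselsTate (hCT : exists_casselsTate_pairing (K := ℚ))
    [Finite W.sha] : Even (padicValNat p W.shaOrder) := by
  obtain ⟨r, hr2⟩ := isSquare_card_sha_of_finite_of_casselsTate hCT W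
  have hpos : 0 < Nat.card W.sha := Nat.card_pos
  have hr0 : r ≠ 0 := by rintro rfl; simp at hr2; omega
  refine ⟨padicValNat p r, ?_⟩
  unfold WeierstrassCurve.shaOrder
  rw [hr2, padicValNat.mul hr0 hr0]

/-- **X11a, per pair, ONE LEVEL DEEPER: the lower half from a Kurihara number non-zero modulo `p^k`
with `k ≤ ord_p ∏ c_ℓ + 2`, when `ord_p #Ш_an` is even** (literal Kim fact `hKim`; Cassels–Tate
`hCT`). Kim's `ord_p(L(E,1)/Ω) ≤ ord_p #Ш(p) + (k − 1)` and `ord_p(L(E,1)/Ω) = ord_p #Ш_an + ord_p ∏ c_ℓ`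
give `ord_p #Ш_an − 1 ≤ ord_p #Ш`; both sides even ⇒ `ord_p #Ш_an ≤ ord_p #Ш`. Displayed per pair in
addition to §1: `#Ш_an = A` with `ord_p A` even (`A = 25` on the six target pairs). Per pair; NOT a
class theorem.
[cite: Kim2022StructureSelmer, Thm. 1.9 (6) (PDF p. 8) and §1.5.1 (PDF p. 7)]
[cite: SilvermanAEC2009, Thm. X.4.14] [cite: Miller2011LMS, Def. 1.1 (arXiv:1010.2431 p. 3)] -/
theorem _root_.Summit.BirchSwinnertonDyer.Rank1Residual.ClassX11a.missingLowerBoundAt_of_kimDeep_of_casselsTate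
    (hCT : exists_casselsTate_pairing (K := ℚ))
    (hKim : Kim2026.rankZero_le_padicValNat_sha_of_kuriharaNumber_ne_zero)
    (hϖ : realPeriodRat_eq_unit_mul_plusPeriod_of_multiplicative)
    (hGZK : rank_eq_analyticRank_of_analyticRank_le_one) (hmod : hasEntireLFunction_rat)
    (hX : ClassX11a W p) (hp : 5 ≤ p) (hsurj : Surj W p)
    {N : ℕ} [NeZero N] (D : ModularParametrizationData W N) (hc : ¬ (p : ℤ) ∣ D.maninConstant)
    {A : ℚ} (hA : shaAn W = (A : ℂ)) (hAev : Even (padicValRat p A))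
    (k n : ℕ) [NeZero n] (hk : 1 ≤ k) (hkc : k ≤ padicValNat p W.tamagawaProduct + 2)
    (hn : Kato.IsKolyvaginProduct W p k n)
    (hcyc : ∀ (ℓ : ℕ) [Fact ℓ.Prime], ℓ ∣ n →
      Nat.card {P : ((WeierstrassCurve.integralModelInt W).map
          (Int.castRingHom (ZMod ℓ))).toAffine.Point // p • P = 0} ≤ p)
    (ψ : (ℓ : ℕ) → (ZMod ℓ)ˣ →* Multiplicative (ZMod (p ^ k)))
    (hψ : ∀ ℓ ∈ n.primeFactors, Function.Surjective (ψ ℓ))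
    (hδ : kuriharaNumber D.f (p ^ k) n ψ ≠ 0) : MissingLowerBoundAt W p := by
  have hr : W.analyticRank = 0 := hX.1
  have hL : W.entireLFunction 1 ≠ 0 := (W.analyticRank_eq_zero_iff_holds (hmod W)).mp hr
  have hfin : Finite W.sha := (hGZK W (by rw [hr]; exact zero_le_one)).2
  have hper : ∃ u : ℚ, ‖(u : ℚ_[p])‖ = 1 ∧ W.realPeriodRat = u * plusPeriod D.f :=
    hϖ W p hp hX.2.2.1 hX.2.2.2.1 D.f D.isNewformOf
  obtain ⟨q₀, hq₀, hval⟩ := hKim W p hp hsurj hL hfin D hc hper k n hk hn hcyc ψ hψ hδ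
  obtain ⟨q, hq, hvq⟩ := exists_shaAn_eq_and_padicValRat_eq_of_rankZero hGZK hmod hr hX.2.2.2.1 hq₀
  have hqA : q = A := by exact_mod_cast hq.symm.trans hA
  subst hqA
  haveI : Finite W.sha := hfin
  have hcard : (padicValNat p (Nat.card (AddCommGroup.primaryComponent W.sha p)) : ℤ) =
      padicValNat p W.shaOrder := by
    rw [WeierstrassCurve.shaOrder, padicValNat_card_addPrimaryComponent]
  obtain ⟨a, ha⟩ := hAev
  obtain ⟨b, hb⟩ := even_padicValNat_shaOrder_of_casselsTate (W := W) (p := p) hCT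
  refine ⟨q, hq, ?_⟩
  have hkc' : ((k - 1 : ℕ) : ℤ) ≤ (padicValNat p W.tamagawaProduct : ℤ) + 1 := by omega
  have hb' : (padicValNat p W.shaOrder : ℤ) = b + b := by exact_mod_cast hb
  omega

/-- **The same through the proof-covered twin** (`(t0)` from «non-split or `p ∤ v_p(Δ_min)`»), one
level deeper with Cassels–Tate parity. Per pair; NOT a class theorem. [cite: Miller2011LMS, Def. 1.1]
[cite: Kim2022StructureSelmer, Thm. 1.9 (6) (PDF p. 8), Prop. 3.2, Thm. 3.13] [cite: SilvermanAEC2009, Thm. X.4.14, Thm. VII.6.1 and Exercise 3.5] -/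
theorem _root_.Summit.BirchSwinnertonDyer.Rank1Residual.ClassX11a.missingLowerBoundAt_of_kimDeep_of_localTorsionTrivial_of_casselsTate
    (hCT : exists_casselsTate_pairing (K := ℚ))
    (hKim0 : Kim2026.rankZero_le_padicValNat_sha_of_kuriharaNumber_ne_zero_of_localTorsionTrivial)
    (hϖ : realPeriodRat_eq_unit_mul_plusPeriod_of_multiplicative)
    (hGZK : rank_eq_analyticRank_of_analyticRank_le_one) (hmod : hasEntireLFunction_rat)
    (hX : ClassX11a W p) (hp : 5 ≤ p) (hsurj : Surj W p)
    (h0 : ¬ W.HasSplitMultiplicativeReductionAtPrime p ∨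
      ¬ p ∣ padicValInt p W.minimalDiscriminantInt)
    {N : ℕ} [NeZero N] (D : ModularParametrizationData W N) (hc : ¬ (p : ℤ) ∣ D.maninConstant)
    {A : ℚ} (hA : shaAn W = (A : ℂ)) (hAev : Even (padicValRat p A))
    (k n : ℕ) [NeZero n] (hk : 1 ≤ k) (hkc : k ≤ padicValNat p W.tamagawaProduct + 2)
    (hn : Kato.IsKolyvaginProduct W p k n)
    (hcyc : ∀ (ℓ : ℕ) [Fact ℓ.Prime], ℓ ∣ n →
      Nat.card {P : ((WeierstrassCurve.integralModelInt W).map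
          (Int.castRingHom (ZMod ℓ))).toAffine.Point // p • P = 0} ≤ p)
    (ψ : (ℓ : ℕ) → (ZMod ℓ)ˣ →* Multiplicative (ZMod (p ^ k)))
    (hψ : ∀ ℓ ∈ n.primeFactors, Function.Surjective (ψ ℓ))
    (hδ : kuriharaNumber D.f (p ^ k) n ψ ≠ 0) : MissingLowerBoundAt W p := by
  have hr : W.analyticRank = 0 := hX.1
  have hL : W.entireLFunction 1 ≠ 0 := (W.analyticRank_eq_zero_iff_holds (hmod W)).mp hr
  have hfin : Finite W.sha := (hGZK W (by rw [hr]; exact zero_le_one)).2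
  have hper : ∃ u : ℚ, ‖(u : ℚ_[p])‖ = 1 ∧ W.realPeriodRat = u * plusPeriod D.f :=
    hϖ W p hp hX.2.2.1 hX.2.2.2.1 D.f D.isNewformOf
  have ht0 : Nat.card {Q : (W.baseChange ℚ_[p]).toAffine.Point // (p : ℕ) • Q = 0} = 1 :=
    natCard_localPTorsion_eq_one_of_mult W p (by omega) hX.2.2.1 h0
  obtain ⟨q₀, hq₀, hval⟩ := hKim0 W p hp hsurj ht0 hL hfin D hc hper k n hk hn hcyc ψ hψ hδ
  obtain ⟨q, hq, hvq⟩ := exists_shaAn_eq_and_padicValRat_eq_of_rankZero hGZK hmod hr hX.2.2.2.1 hq₀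
  have hqA : q = A := by exact_mod_cast hq.symm.trans hA
  subst hqA
  haveI : Finite W.sha := hfin
  have hcard : (padicValNat p (Nat.card (AddCommGroup.primaryComponent W.sha p)) : ℤ) =
      padicValNat p W.shaOrder := by
    rw [WeierstrassCurve.shaOrder, padicValNat_card_addPrimaryComponent]
  obtain ⟨a, ha⟩ := hAev
  obtain ⟨b, hb⟩ := even_padicValNat_shaOrder_of_casselsTate (W := W) (p := p) hCT
  refine ⟨q, hq, ?_⟩
  have hkc' : ((k - 1 : ℕ) : ℤ) ≤ (padicValNat p W.tamagawaProduct : ℤ) + 1 := by omega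
  have hb' : (padicValNat p W.shaOrder : ℤ) = b + b := by exact_mod_cast hb
  omega

/-- **`BSD(E,p)` from the deeper certificate** (parity door §4 + Wuthrich Prop. 21). Per pair; NOT a class theorem.
[cite: Wuthrich2014, Prop. 21 (p. 400)] [cite: Kim2022StructureSelmer, Thm. 1.9 (6) (PDF p. 8)] [cite: SilvermanAEC2009, Thm. X.4.14] [cite: Miller2011LMS, Def. 1.1] -/
theorem _root_.Summit.BirchSwinnertonDyer.Rank1Residual.ClassX11a.bsdp_of_kimDeep_of_localTorsionTrivial_of_casselsTate
    (hWu : sha_dvd_analyticSha) (hCT : exists_casselsTate_pairing (K := ℚ))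
    (hKim0 : Kim2026.rankZero_le_padicValNat_sha_of_kuriharaNumber_ne_zero_of_localTorsionTrivial)
    (hϖ : realPeriodRat_eq_unit_mul_plusPeriod_of_multiplicative)
    (hGZK : rank_eq_analyticRank_of_analyticRank_le_one) (hmod : hasEntireLFunction_rat)
    (hX : ClassX11a W p) (hp : 5 ≤ p) (hsurj : Surj W p)
    (h0 : ¬ W.HasSplitMultiplicativeReductionAtPrime p ∨
      ¬ p ∣ padicValInt p W.minimalDiscriminantInt)
    {N : ℕ} [NeZero N] (D : ModularParametrizationData W N) (hc : ¬ (p : ℤ) ∣ D.maninConstant)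
    {A : ℚ} (hA : shaAn W = (A : ℂ)) (hAev : Even (padicValRat p A))
    (k n : ℕ) [NeZero n] (hk : 1 ≤ k) (hkc : k ≤ padicValNat p W.tamagawaProduct + 2)
    (hn : Kato.IsKolyvaginProduct W p k n)
    (hcyc : ∀ (ℓ : ℕ) [Fact ℓ.Prime], ℓ ∣ n →
      Nat.card {P : ((WeierstrassCurve.integralModelInt W).map
          (Int.castRingHom (ZMod ℓ))).toAffine.Point // p • P = 0} ≤ p)
    (ψ : (ℓ : ℕ) → (ZMod ℓ)ˣ →* Multiplicative (ZMod (p ^ k)))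
    (hψ : ∀ ℓ ∈ n.primeFactors, Function.Surjective (ψ ℓ))
    (hδ : kuriharaNumber D.f (p ^ k) n ψ ≠ 0) : BSDp W p :=
  (bsdp_iff_missingLowerBoundAt_of_surj hWu hGZK hmod hX hsurj).2
    (hX.missingLowerBoundAt_of_kimDeep_of_localTorsionTrivial_of_casselsTate hCT hKim0 hϖ hGZK hmod hp
      hsurj h0 D hc hA hAev k n hk hkc hn hcyc ψ hψ hδ)

end Summit.BirchSwinnertonDyer.Rank1Residual.X11a

end
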